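import Mathlib.Algebra.Field.ZMod
import Mathlib.Algebra.Ring.Commute
import Mathlib.Tactic.LinearCombination
import Mathlib.Tactic.Ring
import Mathlib.Tactic.Push
import HarnessLib

/-!
# Venture HSemireg — S4-PUSH corner 2 (twisted sheaves ∕ complexes at `n = 6`), seat `gs-eng-2` (gen 23):
# KERNEL LEG for the UNIQUENESS STEP of THEOREM TIGHT ∕ THEOREM TIGHT-3
# (cell record `general-structure/XCHECK-K0-gs2.md` §4b ∕ §4c ∕ §4d; corner 2's (D3) in `s4push/search-2/PREREG-S2-17.md`)

HONEST FRAMING. Count-neutral infrastructure: an elementary statement about alternating coefficient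
functions over a commutative ring, typed and proved because two pencil theorems of the corner-2 census
rest on it. Nothing here says HC ∕ HC_CM ∕ HC_AV holds; no object, no `σ`, no census count moves.

STATEMENT (coordinates). A 2-form `B = Σ_{i<j} β i j · eⁱ∧eʲ` on an index type `ι` is an alternating
coefficient function `β` (`IsAlt`); its DIVIDED SQUARE `B^{[2]}` (`B ∧ B = 2 · B^{[2]}`, meaningful in
characteristic 2) has on `eⁱ∧eʲ∧eᵏ∧eˡ` the `4 × 4` Pfaffian minor `pf4 β i j k l`. A SLOT PATTERN is a
family of `m ≥ 3` pairwise disjoint ordered pairs `(a s, b s)` of indices (`SlotPattern`) inside an index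
type of ANY size (the ambient dimension is free — restriction to six indices does not give that); its
STANDARD FORM is `H = Σ_s e^{a s}∧e^{b s}` (`SlotPattern.IsStdForm`). MAIN THEOREM `pf4_eq_smul_pf4_iff`
(commutative ring without zero divisors; `B` alternating, `κ ≠ 0`): `B^{[2]} = κ · H^{[2]}` ⟺ `B = μ · H`
with `μ² = κ`. COROLLARIES: `κ = 1` ⟹ `B = ±H` (`eq_or_eq_neg_of_pf4_eq`: §4c ∕ THEOREM TIGHT-3's
«`B̄″ = ±H̄_M`»); over `𝔽₂` ⟹ `B = H` (`eq_of_pf4_eq_zmod_two`: THEOREM TIGHT §4b's uniqueness); and the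
two literal census instances on `Fin 12` (`census_dim12_six_slots_zmod2`, `census_dim12_four_slots_zmod3`),
machine-certified earlier by SAT + DRAT in dimension 12 (kit j223732 ∕ j223896 of the cell record).
PROOF (the pencil of §4b). The Pfaffian expansion along an index `a` satisfies the cubic identity
`Σ ± β a j · pf4 β a k l m = 0` (`(ι_a B)∧(ι_a B)∧B = 0`; a `ring` identity). At `a = a s` on
`(x, b s, a t, b t)` with a second slot `t` avoiding `x` (where `m ≥ 3` enters) the hypothesis leaves
`β (a s) x · κ = 0`: rows through slot indices are supported on the partner. Two slots then give
`β(a s,b s) · β(a t,b t) = κ`, a third slot makes the diagonal coefficients equal, and a slot plus a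
non-slot pair kills the rest. (`m = 2` fails: 28 roots in dimension 4 over `𝔽₂`.)
-/

namespace Summit.Ventures.HSemireg.DividedSquareUniqueness

variable {F : Type*} [CommRing F] {ι S : Type*}

/-- The `4 × 4` Pfaffian minor of a coefficient function `β`: the coefficient of the divided square
`B^{[2]}` of `B = Σ_{i<j} β i j · eⁱ∧eʲ` on `eⁱ∧eʲ∧eᵏ∧eˡ` (pairwise distinct indices). -/
def pf4 (β : ι → ι → F) (i j k l : ι) : F := β i j * β k l - β i k * β j l + β i l * β j k

/-- `β` is the coefficient function of a 2-form: zero diagonal and antisymmetric (both kept, so that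
characteristic 2 is covered). -/
structure IsAlt (β : ι → ι → F) : Prop where
  /-- zero diagonal -/ diag : ∀ i, β i i = 0
  /-- antisymmetry -/ swap : ∀ i j, β j i = -β i j

/-- The cubic expansion identity `(ι_a B)∧(ι_a B)∧B = 0` in Pfaffian coordinates (pure `ring`). -/
theorem pf4_expansion_identity (β : ι → ι → F) (a j k l m : ι) :
    β a j * pf4 β a k l m - β a k * pf4 β a j l m + β a l * pf4 β a j k m - β a m * pf4 β a j k l = 0 := by
  unfold pf4; ring  -- every monomial `β a _ · β a _ · β _ _` occurs twice with opposite signs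

/-- Divided squares are quadratic: `(μ · H)^{[2]} = μ² · H^{[2]}`. -/
theorem pf4_smul (μ : F) (η : ι → ι → F) (i j k l : ι) :
    pf4 (fun i j => μ * η i j) i j k l = μ ^ 2 * pf4 η i j k l := by unfold pf4; ring

/-- If `B^{[2]} = κ · H^{[2]}` holds on pairwise distinct quadruples (where it is a statement about
4-forms), it holds on all quadruples: on a quadruple with a repeated index both Pfaffian minors of
alternating functions vanish. -/
theorem pf4_eq_of_forall_distinct {β η : ι → ι → F} (hβ : IsAlt β) (hη : IsAlt η) (κ : F)
    (h : ∀ i j k l, i ≠ j → i ≠ k → i ≠ l → j ≠ k → j ≠ l → k ≠ l →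
      pf4 β i j k l = κ * pf4 η i j k l)
    (i j k l : ι) : pf4 β i j k l = κ * pf4 η i j k l := by
  classical
  by_cases hij : i = j
  · simp only [hij, pf4, hβ.diag, hη.diag]; ring
  by_cases hik : i = k
  · simp only [hik, pf4, hβ.diag, hη.diag, hβ.swap k j, hη.swap k j]; ring
  by_cases hil : i = l
  · simp only [hil, pf4, hβ.diag, hη.diag, hβ.swap l k, hη.swap l k, hβ.swap l j, hη.swap l j]; ring
  by_cases hjk : j = k
  · simp only [hjk, pf4, hβ.diag, hη.diag]; ring
  by_cases hjl : j = l
  · simp only [hjl, pf4, hβ.diag, hη.diag, hβ.swap l k, hη.swap l k]; ring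
  by_cases hkl : k = l
  · simp only [hkl, pf4, hβ.diag, hη.diag]; ring
  exact h i j k l hij hik hil hjk hjl hkl

/-- A SLOT PATTERN in the index type `ι`: slots `s : S`, each an ordered pair of indices `(a s, b s)`,
all `2 · #S` indices pairwise distinct, with a base slot and, for any two slots, a third one (`#S ≥ 3`).
Its standard form is `H = Σ_s e^{a s} ∧ e^{b s}`. -/
structure SlotPattern (S ι : Type*) where
  /-- first index of slot `s` -/ a : S → ι
  /-- second index of slot `s` -/ b : S → ι
  /-- distinct slots have distinct first indices -/ a_injective : Function.Injective a
  /-- distinct slots have distinct second indices -/ b_injective : Function.Injective b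
  /-- no first index is a second index -/ a_ne_b : ∀ s t, a s ≠ b t
  /-- a base slot (the pattern is non-empty) -/ base : S
  /-- for any two slots there is a third one -/ third : ∀ s t : S, ∃ u, u ≠ s ∧ u ≠ t

namespace SlotPattern

variable (P : SlotPattern S ι)

/-- For a slot `s` and an index `x` there is another slot `t ≠ s` not containing `x`. -/
theorem exists_slot_avoiding (s : S) (x : ι) : ∃ t, t ≠ s ∧ x ≠ P.a t ∧ x ≠ P.b t := by
  classical
  obtain ⟨t₁, ht₁s, -⟩ := P.third s s
  obtain ⟨t₂, ht₂s, ht₂t₁⟩ := P.third s t₁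
  by_cases h1 : x = P.a t₁
  · exact ⟨t₂, ht₂s, fun h => ht₂t₁ (P.a_injective (h.symm.trans h1)),
      fun h => P.a_ne_b t₁ t₂ (h1.symm.trans h)⟩
  by_cases h2 : x = P.b t₁
  · exact ⟨t₂, ht₂s, fun h => P.a_ne_b t₂ t₁ (h.symm.trans h2),
      fun h => ht₂t₁ (P.b_injective (h.symm.trans h2))⟩
  exact ⟨t₁, ht₁s, h1, h2⟩

/-- `η` is the coefficient function of the STANDARD FORM `H = Σ_s e^{a s} ∧ e^{b s}` of the pattern:
`1` on slots `(a s, b s)`, `-1` on reversed slots, `0` on every other ordered pair. -/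
structure IsStdForm (η : ι → ι → F) : Prop where
  /-- coefficient `1` on a slot -/ ab : ∀ s, η (P.a s) (P.b s) = 1
  /-- coefficient `-1` on a reversed slot -/ ba : ∀ s, η (P.b s) (P.a s) = -1
  /-- coefficient `0` on every ordered pair that is neither a slot nor a reversed slot -/
  zero : ∀ i j, (∀ s, ¬(i = P.a s ∧ j = P.b s)) → (∀ s, ¬(i = P.b s ∧ j = P.a s)) → η i j = 0

namespace IsStdForm

variable {P} {η : ι → ι → F} (hη : P.IsStdForm η)
include hη

/-- standard form: `η (a s) (a t) = 0` -/
theorem aa (s t : S) : η (P.a s) (P.a t) = 0 :=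
  hη.zero _ _ (fun u h => P.a_ne_b t u h.2) (fun u h => P.a_ne_b s u h.1)

/-- standard form: `η (b s) (b t) = 0` -/
theorem bb (s t : S) : η (P.b s) (P.b t) = 0 :=
  hη.zero _ _ (fun u h => P.a_ne_b u s h.1.symm) (fun u h => P.a_ne_b u t h.2.symm)

/-- standard form: `η (a s) (b t) = 0` for `s ≠ t` -/
theorem ab_of_ne {s t : S} (hst : s ≠ t) : η (P.a s) (P.b t) = 0 :=
  hη.zero _ _ (fun _ h => hst ((P.a_injective h.1).trans (P.b_injective h.2).symm))
    (fun u h => P.a_ne_b s u h.1)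

/-- standard form: `η (b s) (a t) = 0` for `s ≠ t` -/
theorem ba_of_ne {s t : S} (hst : s ≠ t) : η (P.b s) (P.a t) = 0 :=
  hη.zero _ _ (fun u h => P.a_ne_b u s h.1.symm)
    (fun _ h => hst ((P.b_injective h.1).trans (P.a_injective h.2).symm))

/-- standard form: the row of `a s` is supported on `b s` -/
theorem a_left (s : S) {x : ι} (hx : x ≠ P.b s) : η (P.a s) x = 0 :=
  hη.zero _ _ (fun _ h => hx (h.2.trans (congrArg P.b (P.a_injective h.1)).symm))
    (fun u h => P.a_ne_b s u h.1)

/-- standard form: the row of `b s` is supported on `a s` -/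
theorem b_left (s : S) {x : ι} (hx : x ≠ P.a s) : η (P.b s) x = 0 :=
  hη.zero _ _ (fun u h => P.a_ne_b u s h.1.symm)
    (fun _ h => hx (h.2.trans (congrArg P.a (P.b_injective h.1)).symm))

/-- standard form: the column of `a t` is supported on `b t` -/
theorem a_right (t : S) {x : ι} (hx : x ≠ P.b t) : η x (P.a t) = 0 :=
  hη.zero _ _ (fun u h => P.a_ne_b t u h.2)
    (fun _ h => hx (h.1.trans (congrArg P.b (P.a_injective h.2)).symm))

/-- standard form: the column of `b t` is supported on `a t` -/
theorem b_right (t : S) {x : ι} (hx : x ≠ P.a t) : η x (P.b t) = 0 :=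
  hη.zero _ _ (fun _ h => hx (h.1.trans (congrArg P.a (P.b_injective h.2)).symm))
    (fun u h => P.a_ne_b u t h.2.symm)

/-- The standard form is alternating. -/
theorem isAlt : IsAlt η := by
  classical
  refine ⟨fun i => hη.zero i i (fun u h => P.a_ne_b u u (h.1.symm.trans h.2))
    (fun u h => P.a_ne_b u u (h.2.symm.trans h.1)), fun i j => ?_⟩
  by_cases h1 : ∃ s, i = P.a s ∧ j = P.b s
  · obtain ⟨s, rfl, rfl⟩ := h1; rw [hη.ab, hη.ba]
  by_cases h2 : ∃ s, i = P.b s ∧ j = P.a s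
  · obtain ⟨s, rfl, rfl⟩ := h2; rw [hη.ab, hη.ba, neg_neg]
  push Not at h1 h2
  rw [hη.zero i j (fun s h => h1 s h.1 h.2) (fun s h => h2 s h.1 h.2),
    hη.zero j i (fun s h => h2 s h.2 h.1) (fun s h => h1 s h.2 h.1), neg_zero]

/-- `H^{[2]}` on two slots: coefficient `1`. -/
theorem pf4_slot_slot {s t : S} (hst : s ≠ t) : pf4 η (P.a s) (P.b s) (P.a t) (P.b t) = 1 := by
  rw [pf4, hη.ab s, hη.ab t, hη.aa s t, hη.ab_of_ne hst]; ring

end IsStdForm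

end SlotPattern

section main

variable [NoZeroDivisors F] (P : SlotPattern S ι) {η β : ι → ι → F} {κ : F}

/-- STEP 1a. If `B^{[2]} = κ H^{[2]}` (all quadruples) with `κ ≠ 0`, the row of `B` through `a s` is
supported on `b s`: `β (a s) x = 0` for `x ≠ b s` (expansion identity at `a s` on `(x, b s, a t, b t)`,
`t` a second slot avoiding `x` — this is where the third slot enters). -/
theorem row_a_eq_zero (hη : P.IsStdForm η) (hκ : κ ≠ 0)
    (hB : ∀ i j k l, pf4 β i j k l = κ * pf4 η i j k l) (s : S) {x : ι}
    (hxb : x ≠ P.b s) : β (P.a s) x = 0 := by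
  obtain ⟨t, hts, hxat, hxbt⟩ := P.exists_slot_avoiding s x
  have hst : s ≠ t := fun h => hts h.symm
  have h := pf4_expansion_identity β (P.a s) x (P.b s) (P.a t) (P.b t)
  have e2 : pf4 η (P.a s) x (P.a t) (P.b t) = 0 := by rw [pf4, hη.a_left s hxb, hη.aa s t, hη.ab_of_ne hst]; ring
  have e3 : pf4 η (P.a s) x (P.b s) (P.b t) = 0 := by
    rw [pf4, hη.a_left s hxb, hη.ab s, hη.ab_of_ne hst, hη.b_right t hxat]; ring
  have e4 : pf4 η (P.a s) x (P.b s) (P.a t) = 0 := by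
    rw [pf4, hη.a_left s hxb, hη.ab s, hη.a_right t hxbt, hη.aa s t]; ring
  rw [hB (P.a s) (P.b s), hB (P.a s) x (P.a t), hB (P.a s) x (P.b s) (P.b t),
    hB (P.a s) x (P.b s) (P.a t), hη.pf4_slot_slot hst, e2, e3, e4] at h
  have key : β (P.a s) x * κ = 0 := by linear_combination h
  exact (mul_eq_zero.mp key).resolve_right hκ

/-- STEP 1b. Likewise the row of `B` through `b s` is supported on `a s`: `β (b s) x = 0` for `x ≠ a s`. -/
theorem row_b_eq_zero (hη : P.IsStdForm η) (hκ : κ ≠ 0)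
    (hB : ∀ i j k l, pf4 β i j k l = κ * pf4 η i j k l) (s : S) {x : ι}
    (hxa : x ≠ P.a s) : β (P.b s) x = 0 := by
  obtain ⟨t, hts, hxat, hxbt⟩ := P.exists_slot_avoiding s x
  have hst : s ≠ t := fun h => hts h.symm
  have h := pf4_expansion_identity β (P.b s) x (P.a s) (P.a t) (P.b t)
  have f1 : pf4 η (P.b s) (P.a s) (P.a t) (P.b t) = -1 := by rw [pf4, hη.ba s, hη.ab t, hη.ba_of_ne hst, hη.bb s t]; ring
  have f2 : pf4 η (P.b s) x (P.a t) (P.b t) = 0 := by rw [pf4, hη.b_left s hxa, hη.ba_of_ne hst, hη.bb s t]; ring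
  have f3 : pf4 η (P.b s) x (P.a s) (P.b t) = 0 := by
    rw [pf4, hη.b_left s hxa, hη.ba s, hη.b_right t hxat, hη.bb s t]; ring
  have f4 : pf4 η (P.b s) x (P.a s) (P.a t) = 0 := by
    rw [pf4, hη.b_left s hxa, hη.ba s, hη.a_right t hxbt, hη.ba_of_ne hst]; ring
  rw [hB (P.b s) (P.a s), hB (P.b s) x (P.a t), hB (P.b s) x (P.a s) (P.b t),
    hB (P.b s) x (P.a s) (P.a t), f1, f2, f3, f4] at h
  have key : β (P.b s) x * κ = 0 := by linear_combination -h
  exact (mul_eq_zero.mp key).resolve_right hκ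

/-- STEP 2. On two distinct slots, `B^{[2]} = κ H^{[2]}` reads `β (a s) (b s) · β (a t) (b t) = κ`. -/
theorem diag_mul_diag (hη : P.IsStdForm η) (hκ : κ ≠ 0)
    (hB : ∀ i j k l, pf4 β i j k l = κ * pf4 η i j k l) {s t : S} (hst : s ≠ t) :
    β (P.a s) (P.b s) * β (P.a t) (P.b t) = κ := by
  have h := hB (P.a s) (P.b s) (P.a t) (P.b t)
  rw [pf4, hη.pf4_slot_slot hst, row_a_eq_zero P hη hκ hB s (P.a_ne_b t s),
    row_a_eq_zero P hη hκ hB s (fun h => hst (P.b_injective h).symm)] at h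
  linear_combination h

/-- STEP 3. A third slot makes all diagonal coefficients equal. -/
theorem diag_eq_diag (hη : P.IsStdForm η) (hκ : κ ≠ 0)
    (hB : ∀ i j k l, pf4 β i j k l = κ * pf4 η i j k l) (s t : S) :
    β (P.a s) (P.b s) = β (P.a t) (P.b t) := by
  classical
  by_cases hst : s = t
  · rw [hst]
  obtain ⟨u, hus, hut⟩ := P.third s t
  have h1 := diag_mul_diag P hη hκ hB (fun h => hus h.symm : s ≠ u)
  have h2 := diag_mul_diag P hη hκ hB (fun h => hut h.symm : t ≠ u)
  have hu : β (P.a u) (P.b u) ≠ 0 := by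
    intro h0; apply hκ; rw [← h1, h0, mul_zero]
  have key : (β (P.a s) (P.b s) - β (P.a t) (P.b t)) * β (P.a u) (P.b u) = 0 := by
    linear_combination h1 - h2
  exact sub_eq_zero.mp ((mul_eq_zero.mp key).resolve_right hu)

/-- STEP 4 (forward direction). `B^{[2]} = κ · H^{[2]}` on pairwise distinct quadruples, `κ ≠ 0`,
`m ≥ 3` slots, ANY ambient index type ⟹ `B = μ · H` with `μ² = κ`. -/
theorem exists_eq_smul (hη : P.IsStdForm η) (hβ : IsAlt β) (hκ : κ ≠ 0)
    (hB : ∀ i j k l, i ≠ j → i ≠ k → i ≠ l → j ≠ k → j ≠ l → k ≠ l →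
      pf4 β i j k l = κ * pf4 η i j k l) :
    ∃ μ : F, μ ^ 2 = κ ∧ ∀ i j, β i j = μ * η i j := by
  classical
  have hB' := pf4_eq_of_forall_distinct hβ hη.isAlt κ hB
  have hμκ : β (P.a P.base) (P.b P.base) ^ 2 = κ := by
    obtain ⟨t, ht, -⟩ := P.third P.base P.base
    linear_combination diag_mul_diag P hη hκ hB' (fun h => ht h.symm : P.base ≠ t) +
      β (P.a P.base) (P.b P.base) * diag_eq_diag P hη hκ hB' P.base t
  have hμ0 : β (P.a P.base) (P.b P.base) ≠ 0 := by
    intro h0; apply hκ; rw [← hμκ, h0]; ring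
  refine ⟨β (P.a P.base) (P.b P.base), hμκ, fun i j => ?_⟩
  by_cases hi : ∃ s, i = P.a s ∨ i = P.b s
  · obtain ⟨s, hi⟩ := hi
    rcases hi with rfl | rfl
    · by_cases hj : j = P.b s
      · subst hj; rw [hη.ab, mul_one]; exact diag_eq_diag P hη hκ hB' s P.base
      rw [row_a_eq_zero P hη hκ hB' s hj, hη.a_left s hj, mul_zero]
    · by_cases hj : j = P.a s
      · subst hj
        rw [hβ.swap (P.a s) (P.b s), hη.ba, diag_eq_diag P hη hκ hB' s P.base]; ring
      rw [row_b_eq_zero P hη hκ hB' s hj, hη.b_left s hj, mul_zero]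
  push Not at hi
  have hη0 : η i j = 0 := hη.zero i j (fun s h => (hi s).1 h.1) (fun s h => (hi s).2 h.1)
  rw [hη0, mul_zero]
  by_cases hj : ∃ t, j = P.a t ∨ j = P.b t
  · obtain ⟨t, hj⟩ := hj
    rcases hj with rfl | rfl
    · rw [hβ.swap (P.a t) i, row_a_eq_zero P hη hκ hB' t (hi t).2, neg_zero]
    · rw [hβ.swap (P.b t) i, row_b_eq_zero P hη hκ hB' t (hi t).1, neg_zero]
  push Not at hj
  by_cases hij : i = j
  · subst hij; exact hβ.diag i
  have h := hB' (P.a P.base) (P.b P.base) i j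
  have e : pf4 η (P.a P.base) (P.b P.base) i j = 0 := by
    rw [pf4, hη.ab, hη0, hη.a_left P.base (hi P.base).2, hη.a_left P.base (hj P.base).2]; ring
  rw [pf4, e, mul_zero, row_a_eq_zero P hη hκ hB' P.base (hi P.base).2,
    row_a_eq_zero P hη hκ hB' P.base (hj P.base).2] at h
  have key : β (P.a P.base) (P.b P.base) * β i j = 0 := by linear_combination h
  exact (mul_eq_zero.mp key).resolve_left hμ0

/-- **UNIQUENESS OF DIVIDED-SQUARE ROOTS ON `m ≥ 3` SLOTS (any ambient dimension; any commutative ring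
without zero divisors).** For alternating `B`, the standard form `H` of a slot pattern (`≥ 3` slots) and
`κ ≠ 0`:  `B^{[2]} = κ · H^{[2]}`  ⟺  `B = μ · H` for some `μ` with `μ² = κ`. This is the uniqueness step
of THEOREM TIGHT (§4b) and of §4c ∕ THEOREM TIGHT-3 (§4d) of the cell record, and the `K_m` clause of
corner 2's divided-square lemma (D3), for all `m ≥ 3` at once. -/
theorem pf4_eq_smul_pf4_iff (hη : P.IsStdForm η) (hβ : IsAlt β) (hκ : κ ≠ 0) :
    (∀ i j k l, i ≠ j → i ≠ k → i ≠ l → j ≠ k → j ≠ l → k ≠ l →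
      pf4 β i j k l = κ * pf4 η i j k l) ↔
    ∃ μ : F, μ ^ 2 = κ ∧ ∀ i j, β i j = μ * η i j := by
  refine ⟨exists_eq_smul P hη hβ hκ, fun ⟨μ, hμ, h⟩ i j k l _ _ _ _ _ _ => ?_⟩
  have e : β = fun i j => μ * η i j := funext fun i => funext fun j => h i j
  rw [e, pf4_smul, hμ]

variable [Nontrivial F]

/-- **`κ = 1`: `B^{[2]} = H^{[2]}` ⟹ `B = H` or `B = -H`** (any non-trivial commutative ring without
zero divisors, e.g. any field) — the uniqueness sentence «`B̄″ = ±H̄_M`» of §4c ∕ THEOREM TIGHT-3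
(`p = 3`, `|M| = 4` slots inside dimension 12). -/
theorem eq_or_eq_neg_of_pf4_eq (hη : P.IsStdForm η) (hβ : IsAlt β)
    (hB : ∀ i j k l, i ≠ j → i ≠ k → i ≠ l → j ≠ k → j ≠ l → k ≠ l →
      pf4 β i j k l = pf4 η i j k l) :
    β = η ∨ β = fun i j => -η i j := by
  obtain ⟨μ, hμ, h⟩ := exists_eq_smul P hη hβ (one_ne_zero : (1 : F) ≠ 0)
    (fun i j k l h₁ h₂ h₃ h₄ h₅ h₆ => by rw [one_mul]; exact hB i j k l h₁ h₂ h₃ h₄ h₅ h₆)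
  rcases sq_eq_one_iff.mp hμ with rfl | rfl
  · left; funext i j; rw [h, one_mul]
  · right; funext i j; rw [h, neg_one_mul]

end main

/-- **Over `𝔽₂`: `B^{[2]} = H^{[2]}` ⟹ `B = H`** — the uniqueness sentence of THEOREM TIGHT (§4b:
«the only 2-form with `B^{[2]} = D̄′^{[2]}` on `n ≥ 3` slots is `B = D̄′`»), in every ambient dimension. -/
theorem eq_of_pf4_eq_zmod_two (P : SlotPattern S ι) {η β : ι → ι → ZMod 2} (hη : P.IsStdForm η)
    (hβ : IsAlt β)
    (hB : ∀ i j k l, i ≠ j → i ≠ k → i ≠ l → j ≠ k → j ≠ l → k ≠ l →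
      pf4 β i j k l = pf4 η i j k l) :
    β = η := by
  rcases eq_or_eq_neg_of_pf4_eq P hη hβ hB with h | h
  · exact h
  · rw [h]; funext i j; exact ZMod.neg_eq_self_mod_two _

section census

/-! ### The two census instances (index type `Fin 12`) -/

/-- The slot pattern `(2s, 2s+1)`, `s < m`, inside `Fin 12` (`2m ≤ 12`; the base slot and the
third-slot property are supplied per `m`). For `m < 6` it does NOT exhaust the ambient index type. -/
def finSlots (m : ℕ) (hm : 2 * m ≤ 12) (base : Fin m)
    (third : ∀ s t : Fin m, ∃ u, u ≠ s ∧ u ≠ t) : SlotPattern (Fin m) (Fin 12) where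
  a s := ⟨2 * s.val, by omega⟩
  b s := ⟨2 * s.val + 1, by omega⟩
  a_injective s t h := Fin.ext (by have := Fin.mk.inj_iff.mp h; omega)
  b_injective s t h := Fin.ext (by have := Fin.mk.inj_iff.mp h; omega)
  a_ne_b s t h := by have := Fin.mk.inj_iff.mp h; omega
  base := base
  third := third

/-- Coefficient function of the standard form on the slots `(2s, 2s+1)`, `s < m`, of `Fin 12`. -/
def stdForm (F : Type*) [CommRing F] (m : ℕ) (i j : Fin 12) : F :=
  if i.val / 2 = j.val / 2 ∧ i.val / 2 < m ∧ i.val % 2 = 0 ∧ j.val % 2 = 1 then 1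
  else if i.val / 2 = j.val / 2 ∧ i.val / 2 < m ∧ i.val % 2 = 1 ∧ j.val % 2 = 0 then -1 else 0

/-- `stdForm F m` is the standard form of `finSlots m`. -/
theorem isStdForm_finSlots (F : Type*) [CommRing F] (m : ℕ) (hm : 2 * m ≤ 12) (base : Fin m)
    (third : ∀ s t : Fin m, ∃ u, u ≠ s ∧ u ≠ t) :
    (finSlots m hm base third).IsStdForm (stdForm F m) := by
  refine ⟨fun s => ?_, fun s => ?_, fun i j h1 h2 => ?_⟩
  · have hs := s.isLt
    simp only [stdForm, finSlots]
    rw [if_pos ⟨by omega, by omega, by omega, by omega⟩]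
  · have hs := s.isLt
    simp only [stdForm, finSlots]
    rw [if_neg (by omega), if_pos ⟨by omega, by omega, by omega, by omega⟩]
  · simp only [stdForm]
    rw [if_neg, if_neg]
    · rintro ⟨h, hm', hi, hj⟩
      exact h2 ⟨i.val / 2, hm'⟩ ⟨Fin.ext (by simp only [finSlots]; omega),
        Fin.ext (by simp only [finSlots]; omega)⟩
    · rintro ⟨h, hm', hi, hj⟩
      exact h1 ⟨i.val / 2, hm'⟩ ⟨Fin.ext (by simp only [finSlots]; omega),
        Fin.ext (by simp only [finSlots]; omega)⟩

/-- **CENSUS INSTANCE 1 (THEOREM TIGHT, `p = 2`, dimension 12, six slots).** Over `𝔽₂`, an alternating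
`B` on `Fin 12` with `B^{[2]} = D̄′^{[2]}`, `D̄′ = Σ_{s<6} e^{2s}∧e^{2s+1}`, IS `D̄′` (the statement
SAT∕DRAT-certified as «exactly one root in dimension 12», kit j223732 of the cell record). -/
theorem census_dim12_six_slots_zmod2 (β : Fin 12 → Fin 12 → ZMod 2) (hβ : IsAlt β)
    (hB : ∀ i j k l, i ≠ j → i ≠ k → i ≠ l → j ≠ k → j ≠ l → k ≠ l →
      pf4 β i j k l = pf4 (stdForm (ZMod 2) 6) i j k l) :
    β = stdForm (ZMod 2) 6 :=
  eq_of_pf4_eq_zmod_two (finSlots 6 (by omega) 0 (by decide))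
    (isStdForm_finSlots (ZMod 2) 6 _ 0 _) hβ hB

/-- **CENSUS INSTANCE 2 (§4c ∕ THEOREM TIGHT-3, `p = 3`, dimension 12, four slots).** Over `𝔽₃`, an
alternating `B` on `Fin 12` with `B^{[2]} = H̄_M^{[2]}`, `H̄_M = Σ_{s<4} e^{2s}∧e^{2s+1}`, is `±H̄_M`
(the statement SAT∕DRAT-certified in dimension 12 over `𝔽₃`, kit j223896 of the cell record). -/
theorem census_dim12_four_slots_zmod3 (β : Fin 12 → Fin 12 → ZMod 3) (hβ : IsAlt β)
    (hB : ∀ i j k l, i ≠ j → i ≠ k → i ≠ l → j ≠ k → j ≠ l → k ≠ l →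
      pf4 β i j k l = pf4 (stdForm (ZMod 3) 4) i j k l) :
    β = stdForm (ZMod 3) 4 ∨ β = fun i j => -stdForm (ZMod 3) 4 i j :=
  eq_or_eq_neg_of_pf4_eq (finSlots 4 (by omega) 0 (by decide))
    (isStdForm_finSlots (ZMod 3) 4 _ 0 _) hβ hB

end census

end Summit.Ventures.HSemireg.DividedSquareUniqueness
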